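import Summits.BirchSwinnertonDyer.BirchSwinnertonDyer.Theorems.UniversalToricDescentBDPFrameCrossPeriodRigidity
import Summits.BirchSwinnertonDyer.BirchSwinnertonDyer.Theorems.ClassRecordThreeLambdaMatchingTransferAlgebra
import Summits.BirchSwinnertonDyer.BirchSwinnertonDyer.Theorems.EisensteinPrimesKatzLineDescent
import Summits.BirchSwinnertonDyer.BirchSwinnertonDyer.Theorems.EisensteinPrimesGoodLatticeHeckeCharOfTeichmullerUnique
import Summits.BirchSwinnertonDyer.BirchSwinnertonDyer.Theorems.EisensteinPrimesKatzLineDescentPeeling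
import Summits.BirchSwinnertonDyer.BirchSwinnertonDyer.Theorems.EisensteinPrimesKatzLineDescentWronskian
import Summits.BirchSwinnertonDyer.BirchSwinnertonDyer.Theorems.EisensteinPrimesKatzLineDescentBinomialBound
import Literature.NumberTheory.EllipticCurves.KellerYin2024.AnomalousCongruenceFullDescentDatum
import HarnessLib

/-!
# The PERIODS axis of the crux-2 CONTENT stub, AS A THEOREM: the first-unit index (`μ = 0 ∧ λ = n`) is the
# SAME for ANY two `R₀` BDP frames and for ANY two `R₀` Katz frames, so
# `KellerYin2024.thm222_anacong_goodLattice_of_fullDescentDatum` (∀ over both period pairs) FOLLOWS from its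
# ∃-frames form («ONE BDP frame and ONE Katz frame with the λ-relation»)
# (helper file for crux 2 `GoodLatticeBDPValue`, stmt-BirchSwinnertonDyer-19032, line `halves` v33N; closes no stub)

Cell `bsd-eis`, width seat `bsd-line-x1-p1-w8` gen 23 (2026-08-29). THEOREMS ONLY (no definition, no named
fact, no `sorry`; imports no `Theses` module); `--supports stmt-BirchSwinnertonDyer-19032`.

WHY. The registered CONTENT stub `stub_anacongOfFullDescentDatum` of `Cruxes/GoodLatticeBDPValue/Lines/halves.lean`
(v33N) is, token for token, the Literature `Prop` `KellerYin2024.thm222_anacong_goodLattice_of_fullDescentDatum`.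
Its conclusion `∃ n nφ, FirstUnitCoeffAt L n ∧ FirstUnitCoeffAt Lφ nφ ∧ n + Σ_w λ_w(E) = 2·nφ + Σ_w (λ_w(θsub) +
λ_w(θquot))` is quantified UNIVERSALLY over the BDP frame `(Ω_K, Ω_p, L)` of `f_E` and over the Katz frame
`(Ω_K', Ω_p', L_φ)` of `θ_K` — ANY non-zero complex periods, ANY `p`-adic unit periods — whereas print (CGLS
Thms. 2.2.1/2.2.2 with (2.16) ∘ Kriz) proves the relation for ITS frames (CM periods). Width seat -w2's binder
audit (evidence #46 on the item, Axis 6 «periods / L») recorded this axis as «not stronger than print» in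
PROSE; this file is the KERNEL form of that verdict, assembled from tree theorems:

* §1 `firstUnitCoeffAt_of_isBDPLFunction_of_isBDPLFunction` — for `K` imaginary quadratic, `κ`
  anticyclotomic with topological generator `γ`, two series `L, L' ∈ R₀⟦T⟧` with
  `IsBDPLFunction ι 𝔭 κ γ f Ω_K Ω_p L`, `IsBDPLFunction ι 𝔭 κ γ f Ω_K' Ω_p' L'` (all four periods non-zero,
  otherwise arbitrary) have the SAME first-unit index: `FirstUnitCoeffAt L n → FirstUnitCoeffAt L' n` (any
  prime `p`). One line from cell bsd-wall-utd's INTEGRAL CROSS-PERIOD RIGIDITY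
  `UniversalToricDescentTwinSplit.span_singleton_eq_of_isBDPLFunction` («two frames generate the same ideal of
  `R₀⟦T⟧`») and `LambdaMatching.firstUnitCoeffAt_of_span_singleton_eq`; with the `iff`, the index equality
  and the `μ = 0` transfer as corollaries.
* §2 `firstUnitCoeffAt_of_isKatzLFunction_of_isKatzLFunction` — for `p` odd and `θ_K` of finite order, two
  series `L, L'' ∈ R₀⟦T⟧` with `IsKatzLFunction ι v v̄ Cbar κ γ θ_K Ω_K Ω_p L`,
  `IsKatzLFunction ι v v̄ Cbar κ γ θ_K Ω_K'' Ω_p'' L''` have the SAME first-unit index. Read `L` along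
  `R₀ ⊆ 𝓞_{ℂ_p}` as a ♭-frame (`KatzLineRigidity.katzFlat_map_of_isKatzLFunction`) and apply width seat -w4's
  transfer `KatzLineRigidity.firstUnitCoeffAt_of_katzFlat_of_isKatzLFunction` (AN-F₂, route (RIG): the
  `p`-power-map functional equation and its `λ`-rigidity). `isFiniteOrder_of_isHeckeCharOf_of_isResidualPairOver`:
  at the stub's binders `θ_K` IS of finite order (`IsResidualPairOver.pow_sub_one`: `θquot^{p−1} = 1`;
  `EisensteinPrimesMuLambda.exists_heckeCharacter_of_pow_eq_one`: a finite-order Hecke character of `θquot`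
  exists; -w2's `GoodLatticeHeckeCharUnique.heckeCharOf_quot_unique`: it is the only one).
* §3 `thm222_anacong_goodLattice_of_fullDescentDatum_of_existsFrames` — the registered statement FOLLOWS from
  its ∃-FRAMES FORM: same binders through `θ_K`, `Cbar`, then «there exist a BDP frame `(Ω_K, Ω_p, L)` and a
  Katz frame `(Ω_K', Ω_p', L_φ)` and indices `n, n_φ` with `FirstUnitCoeffAt L n`, `FirstUnitCoeffAt L_φ n_φ`
  and the λ-relation». (Conversely the registered statement plus the existence of one BDP frame and one Katz
  frame gives the ∃-frames form by instantiation — not restated.) So the universal quantification over the two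
  period pairs in the CONTENT stub costs exactly ONE frame of each kind: on this axis the stub is print-shaped.

INVENTORY NOTE (for the cell's record; cf. `HOME/line-x1-p1-w2-g16/AXIS6-period-dichotomy-w2g16.md`): the
«period dichotomy» proposed there as a new kernel handle, and its «one missing lemma» («`(1+T)^s·P` has
unbounded coefficients for `s ∉ ℤ_p`, `P ≠ 0` a polynomial»), are ALREADY tree theorems — the dichotomy in
the `R₀` BDP currency is `span_singleton_eq_of_isBDPLFunction` (used in §1), in the Katz/♭ currency it is
`KatzLineDescent.exists_eq_C_mul_binomialSeries_map_mul_of_relation` (`L = c·(1+T)^b·Q`, `b ∈ ℤ_p`, `‖c‖ = 1`,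
file `…KatzLineDescentStructure`), and the lemma is `KatzLineDescent.exists_norm_coeff_le_of_ode_of_mul_polynomial`
(file `…KatzLineDescentPeeling`) with `KatzLineDescent.bddAbove_norm_coeff_binomialSeries_iff`
(file `…KatzLineDescentBinomialBound`); §4 `not_bddAbove_binomialSeries_mul_polynomial` records the lemma BY NAME
as their five-line corollary (nothing is re-proved): for `a ∈ ℂ_p ∖ ℤ_p` and a polynomial `P ≠ 0`, the product
`(1+T)^a · P ∈ ℂ_p⟦T⟧` does NOT have bounded coefficients.

HONEST FRAMING: pure bookkeeping over tree theorems; closes no stub; the registry (halves v33N, 2 LEAD-held stubs)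
is untouched; no summit statement, no case of BSD, no Keller–Yin / CGLS theorem, no crux is proved by this file;
0 cells / labels / tiers move.

References: [CastellaGrossiLeeSkinner2022] Thm. 2.1.2 (the frame of `θ_K`), Thm. 2.2.2 with (2.16);
[Castella2018] Thm. 3.1 (the BDP frame over `R₀`); [Washington1997] §7.1 Prop. 7.2, §7.2 (`μ`, `λ`, the
`p`-power map), §5.1 (binomial coefficients); [Cassels1986] Ch. 6 §5; [KellerYin2024] Thm. 2.2.2 (statement shape
only); [CasselsFrohlichANT1967] Ch. VII §5.1.
-/

-- the summit namespace `Summit.BirchSwinnertonDyer.BirchSwinnertonDyer` repeats the problem name by design (D-0017)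
set_option linter.dupNamespace false
set_option autoImplicit false

noncomputable section

open scoped Classical

open PowerSeries WeierstrassCurve NumberField IsDedekindDomain Field Polynomial
  Literature.NumberTheory.EllipticCurves
  Literature.NumberTheory.EllipticCurves.ModularForms
  Literature.NumberTheory.QuadraticFields
  Literature.NumberTheory.EllipticCurves.Rank1Residual
  Literature.NumberTheory.EllipticCurves.Castella2018
  Literature.NumberTheory.EllipticCurves.GreenbergSelmer
  Literature.NumberTheory.EllipticCurves.GreenbergVatsal2000
  Literature.NumberTheory.GaloisRepresentations
  Literature.NumberTheory.EllipticCurves.CastellaGrossiLeeSkinner2022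
  Literature.NumberTheory.EllipticCurves.KellerYin2024
  Summit.BirchSwinnertonDyer.Rank1Residual
  Summit.BirchSwinnertonDyer.Rank1Residual.X11b
  Summit.BirchSwinnertonDyer.BirchSwinnertonDyer.Theorems

namespace Summit.BirchSwinnertonDyer.BirchSwinnertonDyer.Theorems.GoodLatticeAnacongFrames

/-! ## §1 BDP frames over `R₀`: the first-unit index does not depend on the periods -/

section BDP

variable {p : ℕ} [hp : Fact p.Prime] {K : Type} [Field K] [NumberField K] {N : ℕ}
  {ι : PadicAlgCl p ≃+* ℂ} {𝔭 : HeightOneSpectrum (𝓞 K)} {κ : ZpExtension K p}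
  {γ : absoluteGaloisGroup K} {f : CuspForm (CongruenceSubgroup.Gamma0 N) 2}
  {ΩK ΩK' : ℂ} {Ωp Ωp' : ℂ_[p]} {L L' : UnrSeries p}

/-- **The first-unit index passes between ANY two `R₀` BDP frames.** `K` imaginary quadratic, `κ`
anticyclotomic with topological generator `γ`, periods `Ω_K, Ω_K' ∈ ℂ` and `Ω_p, Ω_p' ∈ ℂ_p` non-zero and
otherwise arbitrary: if `L, L'` carry the BDP interpolation property of the same `(ι, 𝔭, κ, γ, f)` and the
first coefficient of `L` of norm `1` sits at `n`, so does that of `L'` (the two frames generate the same ideal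
of `R₀⟦T⟧`, and `FirstUnitCoeffAt` depends only on the principal ideal). Any prime `p`.
[cite: Castella2018, Thm. 3.1 (arXiv:1704.06608 p. 9)] [cite: Washington1997, §7.1 Prop. 7.2] -/
theorem firstUnitCoeffAt_of_isBDPLFunction_of_isBDPLFunction (hK : IsImaginaryQuadratic K)
    (hκ : κ.IsAnticyclotomic) (hγ : κ.IsTopGenerator γ) (hΩK : ΩK ≠ 0) (hΩK' : ΩK' ≠ 0)
    (hΩp : Ωp ≠ 0) (hΩp' : Ωp' ≠ 0) (hL : IsBDPLFunction ι 𝔭 κ γ f ΩK Ωp L)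
    (hL' : IsBDPLFunction ι 𝔭 κ γ f ΩK' Ωp' L') {n : ℕ} (h : FirstUnitCoeffAt L n) :
    FirstUnitCoeffAt L' n :=
  LambdaMatching.firstUnitCoeffAt_of_span_singleton_eq
    (UniversalToricDescentTwinSplit.span_singleton_eq_of_isBDPLFunction hK hκ hγ hΩK hΩK' hΩp hΩp' hL hL')
    h

/-- `FirstUnitCoeffAt L n ↔ FirstUnitCoeffAt L' n` for any two `R₀` BDP frames of the same
`(ι, 𝔭, κ, γ, f)` (symmetric form of the previous theorem). [cite: Castella2018, Thm. 3.1] [cite: Washington1997, §7.1 Prop. 7.2] -/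
theorem firstUnitCoeffAt_iff_of_isBDPLFunction (hK : IsImaginaryQuadratic K) (hκ : κ.IsAnticyclotomic)
    (hγ : κ.IsTopGenerator γ) (hΩK : ΩK ≠ 0) (hΩK' : ΩK' ≠ 0) (hΩp : Ωp ≠ 0) (hΩp' : Ωp' ≠ 0)
    (hL : IsBDPLFunction ι 𝔭 κ γ f ΩK Ωp L) (hL' : IsBDPLFunction ι 𝔭 κ γ f ΩK' Ωp' L') (n : ℕ) :
    FirstUnitCoeffAt L n ↔ FirstUnitCoeffAt L' n :=
  ⟨firstUnitCoeffAt_of_isBDPLFunction_of_isBDPLFunction hK hκ hγ hΩK hΩK' hΩp hΩp' hL hL',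
    firstUnitCoeffAt_of_isBDPLFunction_of_isBDPLFunction hK hκ hγ hΩK' hΩK hΩp' hΩp hL' hL⟩

/-- **The `λ`-index of an `R₀` BDP frame does not depend on the periods**: first-unit indices of two
frames of the same `(ι, 𝔭, κ, γ, f)` are equal. [cite: Castella2018, Thm. 3.1] [cite: Washington1997, §7.1 Prop. 7.2] -/
theorem firstUnitCoeffAt_index_eq_of_isBDPLFunction (hK : IsImaginaryQuadratic K)
    (hκ : κ.IsAnticyclotomic) (hγ : κ.IsTopGenerator γ) (hΩK : ΩK ≠ 0) (hΩK' : ΩK' ≠ 0)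
    (hΩp : Ωp ≠ 0) (hΩp' : Ωp' ≠ 0) (hL : IsBDPLFunction ι 𝔭 κ γ f ΩK Ωp L)
    (hL' : IsBDPLFunction ι 𝔭 κ γ f ΩK' Ωp' L') {n n' : ℕ} (h : FirstUnitCoeffAt L n)
    (h' : FirstUnitCoeffAt L' n') : n = n' :=
  (firstUnitCoeffAt_of_isBDPLFunction_of_isBDPLFunction hK hκ hγ hΩK hΩK' hΩp hΩp' hL hL' h).unique h'

/-- **`μ = 0` passes between ANY two `R₀` BDP frames**: if some coefficient of `L` has norm `1`, so does
some coefficient of `L'`. [cite: Castella2018, Thm. 3.1] [cite: Washington1997, §7.1 Prop. 7.2] -/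
theorem exists_coeff_norm_eq_one_of_isBDPLFunction_of_isBDPLFunction (hK : IsImaginaryQuadratic K)
    (hκ : κ.IsAnticyclotomic) (hγ : κ.IsTopGenerator γ) (hΩK : ΩK ≠ 0) (hΩK' : ΩK' ≠ 0)
    (hΩp : Ωp ≠ 0) (hΩp' : Ωp' ≠ 0) (hL : IsBDPLFunction ι 𝔭 κ γ f ΩK Ωp L)
    (hL' : IsBDPLFunction ι 𝔭 κ γ f ΩK' Ωp' L')
    (hμ : ∃ i : ℕ, ‖((PowerSeries.coeff i L : unrIntegers p) : ℂ_[p])‖ = 1) :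
    ∃ i : ℕ, ‖((PowerSeries.coeff i L' : unrIntegers p) : ℂ_[p])‖ = 1 := by
  obtain ⟨i, hi⟩ := hμ
  obtain ⟨m, -, hm⟩ := X1.KellerYinHalves.exists_firstUnitCoeffAt_of_exists_le (G := L) (N := i)
    ⟨i, le_rfl, by rw [hi]; exact lt_irrefl 1⟩
  exact ⟨m, (firstUnitCoeffAt_of_isBDPLFunction_of_isBDPLFunction hK hκ hγ hΩK hΩK' hΩp hΩp' hL hL'
    hm).1⟩

end BDP

/-! ## §2 Katz frames over `R₀`: the first-unit index does not depend on the periods -/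

section Katz

variable {p : ℕ} [hp : Fact p.Prime] {K : Type} [Field K] [NumberField K]
  {ι : PadicAlgCl p ≃+* ℂ} {v vbar : HeightOneSpectrum (𝓞 K)} {Cbar : Finset (HeightOneSpectrum (𝓞 K))}
  {κ : ZpExtension K p} {γ : absoluteGaloisGroup K} {θK : HeckeCharacter K}
  {ΩK ΩK'' : ℂ} {Ωp Ωp'' : ℂ_[p]} {L L'' : UnrSeries p}

/-- An `R₀`-series read in `𝓞_{ℂ_p}⟦T⟧` keeps its first-unit index (the inclusion `R₀ ⊆ 𝓞_{ℂ_p}`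
preserves norms). [folklore] -/
theorem intFirstUnit_map_unrToCpInt {n : ℕ} (h : FirstUnitCoeffAt L n) :
    ‖((PowerSeries.coeff n (PowerSeries.map (R1.unrToCpInt p) L) : 𝓞_ℂ_[p]) : ℂ_[p])‖ = 1 ∧
      ∀ i < n, ‖((PowerSeries.coeff i (PowerSeries.map (R1.unrToCpInt p) L) : 𝓞_ℂ_[p]) : ℂ_[p])‖ < 1 := by
  refine ⟨?_, fun i hi ↦ ?_⟩
  · rw [PowerSeries.coeff_map, R1.coe_unrToCpInt]; exact h.1
  · rw [PowerSeries.coeff_map, R1.coe_unrToCpInt]; exact h.2 i hi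

/-- **The first-unit index passes between ANY two `R₀` Katz frames of a finite-order `θ_K`.** `p` odd,
`K` imaginary quadratic, `κ` anticyclotomic with topological generator `γ`, `θ_K` of finite order, periods
`Ω_K, Ω_K'' ∈ ℂ` and `Ω_p, Ω_p'' ∈ ℂ_p` non-zero and otherwise arbitrary: if `L, L''` carry the CGLS
interpolation property `IsKatzLFunction ι v v̄ Cbar κ γ θ_K · · ·` and `FirstUnitCoeffAt L n`, then
`FirstUnitCoeffAt L'' n` — read `L` in `𝓞_{ℂ_p}⟦T⟧` (a ♭-frame) and apply the ♭-to-`R₀` transfer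
`KatzLineRigidity.firstUnitCoeffAt_of_katzFlat_of_isKatzLFunction` (power-map functional equation + its
`λ`-rigidity). [cite: CastellaGrossiLeeSkinner2022, Thm. 2.1.2 (arXiv:2008.02571v2 TeX L1015–1041)]
[cite: Washington1997, §7.1 Prop. 7.2, §7.2] -/
theorem firstUnitCoeffAt_of_isKatzLFunction_of_isKatzLFunction (hp2 : p ≠ 2)
    (hK : IsImaginaryQuadratic K) (hκ : κ.IsAnticyclotomic) (hγ : κ.IsTopGenerator γ)
    (hfin : θK.IsFiniteOrder) (hΩK : ΩK ≠ 0) (hΩp : Ωp ≠ 0) (hΩK'' : ΩK'' ≠ 0) (hΩp'' : Ωp'' ≠ 0)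
    (hL : IsKatzLFunction ι v vbar Cbar κ γ θK ΩK Ωp L)
    (hL'' : IsKatzLFunction ι v vbar Cbar κ γ θK ΩK'' Ωp'' L'') {n : ℕ} (h : FirstUnitCoeffAt L n) :
    FirstUnitCoeffAt L'' n :=
  KatzLineRigidity.firstUnitCoeffAt_of_katzFlat_of_isKatzLFunction hp2 hK hκ hγ hfin hΩK hΩp hΩK'' hΩp''
    (KatzLineRigidity.katzFlat_map_of_isKatzLFunction hL) (intFirstUnit_map_unrToCpInt h) hL''

/-- `FirstUnitCoeffAt L n ↔ FirstUnitCoeffAt L'' n` for any two `R₀` Katz frames of the same finite-order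
`θ_K` (symmetric form). [cite: CastellaGrossiLeeSkinner2022, Thm. 2.1.2] [cite: Washington1997, §7.1 Prop. 7.2] -/
theorem firstUnitCoeffAt_iff_of_isKatzLFunction (hp2 : p ≠ 2) (hK : IsImaginaryQuadratic K)
    (hκ : κ.IsAnticyclotomic) (hγ : κ.IsTopGenerator γ) (hfin : θK.IsFiniteOrder) (hΩK : ΩK ≠ 0)
    (hΩp : Ωp ≠ 0) (hΩK'' : ΩK'' ≠ 0) (hΩp'' : Ωp'' ≠ 0)
    (hL : IsKatzLFunction ι v vbar Cbar κ γ θK ΩK Ωp L)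
    (hL'' : IsKatzLFunction ι v vbar Cbar κ γ θK ΩK'' Ωp'' L'') (n : ℕ) :
    FirstUnitCoeffAt L n ↔ FirstUnitCoeffAt L'' n :=
  ⟨firstUnitCoeffAt_of_isKatzLFunction_of_isKatzLFunction hp2 hK hκ hγ hfin hΩK hΩp hΩK'' hΩp'' hL hL'',
    firstUnitCoeffAt_of_isKatzLFunction_of_isKatzLFunction hp2 hK hκ hγ hfin hΩK'' hΩp'' hΩK hΩp hL'' hL⟩

/-- **The `λ`-index of an `R₀` Katz frame of a finite-order `θ_K` does not depend on the periods.**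
[cite: CastellaGrossiLeeSkinner2022, Thm. 2.1.2] [cite: Washington1997, §7.1 Prop. 7.2] -/
theorem firstUnitCoeffAt_index_eq_of_isKatzLFunction (hp2 : p ≠ 2) (hK : IsImaginaryQuadratic K)
    (hκ : κ.IsAnticyclotomic) (hγ : κ.IsTopGenerator γ) (hfin : θK.IsFiniteOrder) (hΩK : ΩK ≠ 0)
    (hΩp : Ωp ≠ 0) (hΩK'' : ΩK'' ≠ 0) (hΩp'' : Ωp'' ≠ 0)
    (hL : IsKatzLFunction ι v vbar Cbar κ γ θK ΩK Ωp L)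
    (hL'' : IsKatzLFunction ι v vbar Cbar κ γ θK ΩK'' Ωp'' L'') {n n'' : ℕ} (h : FirstUnitCoeffAt L n)
    (h'' : FirstUnitCoeffAt L'' n'') : n = n'' :=
  (firstUnitCoeffAt_of_isKatzLFunction_of_isKatzLFunction hp2 hK hκ hγ hfin hΩK hΩp hΩK'' hΩp'' hL hL''
    h).unique h''

/-- **`μ = 0` passes between ANY two `R₀` Katz frames of a finite-order `θ_K`** (`p` odd).
[cite: CastellaGrossiLeeSkinner2022, Thm. 2.1.2] [cite: Washington1997, §7.1–7.2] -/
theorem exists_coeff_norm_eq_one_of_isKatzLFunction_of_isKatzLFunction (hp2 : p ≠ 2)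
    (hK : IsImaginaryQuadratic K) (hκ : κ.IsAnticyclotomic) (hγ : κ.IsTopGenerator γ)
    (hfin : θK.IsFiniteOrder) (hΩK : ΩK ≠ 0) (hΩp : Ωp ≠ 0) (hΩK'' : ΩK'' ≠ 0) (hΩp'' : Ωp'' ≠ 0)
    (hL : IsKatzLFunction ι v vbar Cbar κ γ θK ΩK Ωp L)
    (hL'' : IsKatzLFunction ι v vbar Cbar κ γ θK ΩK'' Ωp'' L'')
    (hμ : ∃ i : ℕ, ‖((PowerSeries.coeff i L : unrIntegers p) : ℂ_[p])‖ = 1) :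
    ∃ i : ℕ, ‖((PowerSeries.coeff i L'' : unrIntegers p) : ℂ_[p])‖ = 1 := by
  obtain ⟨i, hi⟩ := hμ
  refine KatzLineRigidity.exists_coeff_norm_eq_one_of_katzFlat_of_isKatzLFunction hp2 hK hκ hγ hfin hΩK
    hΩp hΩK'' hΩp'' (KatzLineRigidity.katzFlat_map_of_isKatzLFunction hL) hL'' ⟨i, ?_⟩
  rw [PowerSeries.coeff_map, R1.coe_unrToCpInt]
  exact hi

/-- **At the stub's binders `θ_K` has finite order.** For a residual pair `IsResidualPairOver WK p θsub θquot`
(both characters are Teichmüller lifts: `θquot^{p−1} = 1`) and ANY Hecke character `θ_K` with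
`IsHeckeCharOf ι θquot θ_K`, `θ_K` is of finite order: a finite-order Hecke character of `θquot` exists
(`EisensteinPrimesMuLambda.exists_heckeCharacter_of_pow_eq_one`, Artin reciprocity) and the Hecke character of
a Teichmüller character is unique (`GoodLatticeHeckeCharUnique.heckeCharOf_quot_unique`).
[cite: CasselsFrohlichANT1967, Ch. VII §5.1 Main Theorem (A), §4 Prop. 4.1] [cite: KellerYin2024, §1.1 (arXiv:2402.12781v2 TeX L441)] -/
theorem isFiniteOrder_of_isHeckeCharOf_of_isResidualPairOver (S : Set (PadicAlgCl p))
    (ι : PadicAlgCl p ≃+* ℂ) {WK : WeierstrassCurve K}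
    {θsub θquot : FramedGaloisRep K (padicCoeffIntegers S) 1}
    (hpair : IsResidualPairOver WK p θsub θquot) {θK : HeckeCharacter K} (hθK : IsHeckeCharOf ι θquot θK) :
    θK.IsFiniteOrder := by
  obtain ⟨ω, hfin, hω⟩ :=
    EisensteinPrimesMuLambda.exists_heckeCharacter_of_pow_eq_one S ι θquot fun σ ↦ (hpair.pow_sub_one σ).2
  have hωK : IsHeckeCharOf ι θquot ω := hω
  rwa [GoodLatticeHeckeCharUnique.heckeCharOf_quot_unique S ι hpair hθK hωK]

end Katz

/-! ## §3 The CONTENT stub follows from its ∃-frames form -/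

/-- **`KellerYin2024.thm222_anacong_goodLattice_of_fullDescentDatum` (the registered text of crux 2's CONTENT
stub `stub_anacongOfFullDescentDatum`, quantified over ALL BDP frames `(Ω_K, Ω_p, L)` and ALL Katz frames
`(Ω_K', Ω_p', L_φ)`) FOLLOWS from its ∃-FRAMES FORM** — same binders through `θ_K` and `Cbar`, conclusion
«there exist ONE BDP frame of `f_E`, ONE Katz frame of `θ_K`, and indices `n, n_φ` with `FirstUnitCoeffAt L n`,
`FirstUnitCoeffAt L_φ n_φ` and `n + Σ_{w ∈ Sf} λ_w(E/K) = 2 n_φ + Σ_{w ∈ Sf} (λ_w(θsub) + λ_w(θquot))`».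
Proof: the given frames `L`, `L_φ` of the registered statement have the same first-unit indices as the
existential ones by §1 (BDP, any periods) and §2 (Katz, `p` odd from `2 < p`, `θ_K` of finite order by
`isFiniteOrder_of_isHeckeCharOf_of_isResidualPairOver`); the λ-relation is between indices only. So the
universal quantification over both period pairs costs one frame of each kind (the periods axis of the stub is
print-shaped). [cite: CastellaGrossiLeeSkinner2022, Thm. 2.1.2, Thm. 2.2.2 with (2.16) (arXiv:2008.02571v2 TeX L1015–1041, L1132–1153)]
[cite: Castella2018, Thm. 3.1] [cite: KellerYin2024, Thm. 2.2.2 (arXiv:2402.12781v2 TeX L1445–1448) — statement shape only] -/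
theorem thm222_anacong_goodLattice_of_fullDescentDatum_of_existsFrames
    (h : ∀ (W : WeierstrassCurve ℚ) [W.IsElliptic] [W.IsGloballyMinimal] (p : ℕ) [Fact p.Prime],
      2 < p → Good W p → Red W p → Anom W p →
      ((∃ (ℓ : ℕ) (hℓ : ℓ.Prime), haveI : Fact ℓ.Prime := ⟨hℓ⟩; Addv W ℓ) ∨
        (∃ (ℓ : ℕ) (hℓ : ℓ.Prime), haveI : Fact ℓ.Prime := ⟨hℓ⟩;
          W.HasMultiplicativeReductionAtPrime ℓ ∧
            ((W.HasSplitMultiplicativeReductionAtPrime ℓ ∧ ℓ ≡ 1 [MOD p]) ∨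
              (¬ W.HasSplitMultiplicativeReductionAtPrime ℓ ∧ ℓ + 1 ≡ 0 [MOD p])))) →
      (∀ Φ : AddSubgroup (geomTorsion W (p : ℤ)), IsRationalLine W p Φ → ¬ LineUnramifiedAt W p Φ) →
      ∀ (K : Type) [Field K] [NumberField K], IsImaginaryQuadratic K →
        SatisfiesHeegnerHypothesis (W.conductorNorm ℤ) K → SatisfiesHeegnerHypothesis p K →
        Odd (NumberField.discr K) → NumberField.discr K ≠ -3 →
        (∀ Q : (W.baseChange K).toAffine.Point, p • Q = 0 → Q = 0) →
      ∀ (ι : K →+* ℚ_[p]) (v vbar : HeightOneSpectrum (𝓞 K)),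
        (∀ x : 𝓞 K, x ∈ v.asIdeal ↔ ‖ι (x : K)‖ < 1) →
        ((p : ℕ) : 𝓞 K) ∈ vbar.asIdeal → vbar ≠ v →
      ∀ (κ : ZpExtension K p), κ.IsAnticyclotomic →
      ∀ (γ : absoluteGaloisGroup K) [Fact (κ.IsTopGenerator γ)],
      ∀ (N : ℕ) [NeZero N] (Dt : ModularParametrizationData W N),
      ∀ (ι' : PadicAlgCl p ≃+* ℂ),
        (∀ (w : InfinitePlace K) (k : 𝓞 K), k ∈ v.asIdeal ↔ ‖ι'.symm (w.embedding (k : K))‖ < 1) →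
      ∀ (θsub θquot : FramedGaloisRep K (padicCoeffIntegers (∅ : Set (PadicAlgCl p))) 1),
        IsResidualPairOver (W.baseChange K) p θsub θquot →
      ∀ (Sf : Finset (HeightOneSpectrum (𝓞 K))),
        (∀ w : HeightOneSpectrum (𝓞 K), w ∈ Sf ↔ ((W.conductorNorm ℤ : ℤ) : 𝓞 K) ∈ w.asIdeal) →
      ∀ (θK : HeckeCharacter K), IsHeckeCharOf ι' θquot θK →
      ∀ (Cbar : Finset (HeightOneSpectrum (𝓞 K))), (∀ u ∈ Cbar, ¬ θK.IsUnramifiedAt u) →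
      ∃ (ΩK : ℂ) (Ωp : (unrIntegers p)ˣ) (L : UnrSeries p) (ΩK' : ℂ) (Ωp' : (unrIntegers p)ˣ)
        (Lφ : UnrSeries p) (n nφ : ℕ),
        ΩK ≠ 0 ∧ IsBDPLFunction ι' v κ γ Dt.f ΩK ((Ωp : unrIntegers p) : ℂ_[p]) L ∧
        ΩK' ≠ 0 ∧ IsKatzLFunction ι' v vbar Cbar κ γ θK ΩK' ((Ωp' : unrIntegers p) : ℂ_[p]) Lφ ∧
        FirstUnitCoeffAt L n ∧ FirstUnitCoeffAt Lφ nφ ∧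
          n + ∑ w ∈ Sf, curveLocalLambda κ (W.baseChange K) w =
            2 * nφ + ∑ w ∈ Sf, (charLocalLambda ∅ κ θsub w + charLocalLambda ∅ κ θquot w)) :
    thm222_anacong_goodLattice_of_fullDescentDatum := by
  intro W _ _ p _ hp hgood hred hanom hdat hlat K _ _ hK hH hHp hodd hd3 htor ι v vbar hv hvbar hne κ hκ γ _
    N _ Dt ι' hι' ΩK Ωp L hΩ hL θsub θquot hpair Sf hSf θK hθK Cbar hC ΩK' Ωp' Lφ hΩ' hLφ
  obtain ⟨ΩK₀, Ωp₀, L₀, ΩK₀', Ωp₀', Lφ₀, n, nφ, hΩ₀, hL₀, hΩ₀', hLφ₀, hn, hnφ, heq⟩ :=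
    h W p hp hgood hred hanom hdat hlat K hK hH hHp hodd hd3 htor ι v vbar hv hvbar hne κ hκ γ N Dt ι' hι'
      θsub θquot hpair Sf hSf θK hθK Cbar hC
  have hγ : κ.IsTopGenerator γ := Fact.out
  have hp2 : p ≠ 2 := by omega
  have hfin : θK.IsFiniteOrder := isFiniteOrder_of_isHeckeCharOf_of_isResidualPairOver _ ι' hpair hθK
  have hu : ∀ u : (unrIntegers p)ˣ, ((u : unrIntegers p) : ℂ_[p]) ≠ 0 := fun u ↦ by
    rw [← norm_pos_iff, Halves.norm_coe_units_unrIntegers]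
    exact one_pos
  exact ⟨n, nφ,
    firstUnitCoeffAt_of_isBDPLFunction_of_isBDPLFunction hK hκ hγ hΩ₀ hΩ (hu Ωp₀) (hu Ωp) hL₀ hL hn,
    firstUnitCoeffAt_of_isKatzLFunction_of_isKatzLFunction hp2 hK hκ hγ hfin hΩ₀' (hu Ωp₀') hΩ' (hu Ωp')
      hLφ₀ hLφ hnφ,
    heq⟩

/-! ## §4 For the record: «`(1+T)^a · P` is unbounded for `a ∉ ℤ_p`», by name, from the tree -/

section Binomial

variable {p : ℕ} [hp : Fact p.Prime]

/-- **`(1+T)^a · P` has UNBOUNDED coefficients for `a ∈ ℂ_p ∖ ℤ_p` and a polynomial `P ≠ 0`** (the «one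
missing lemma» of the cell memo `AXIS6-period-dichotomy-w2g16.md` §(ii) step 5 — in the tree all along):
`Ψ = (1+T)^a = PowerSeries.binomialSeries ℂ_p a` satisfies `(1+T)·Ψ′ = a·Ψ`
(`KatzLineDescent.one_add_X_mul_derivative_binomialSeries`); if `Ψ·P` were bounded, root peeling
(`KatzLineDescent.exists_norm_coeff_le_of_ode_of_mul_polynomial`) would make `Ψ` bounded, and bounded binomial
coefficients force `a ∈ ℤ_p` (`KatzLineDescent.bddAbove_norm_coeff_binomialSeries_iff`).
[cite: Washington1997, §5.1, §7.1 Prop. 7.2, §7.2] [cite: Cassels1986, Ch. 6 §5] -/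
theorem not_bddAbove_binomialSeries_mul_polynomial {a : ℂ_[p]}
    (ha : ∀ b : ℤ_[p], ((b : ℚ_[p]) : ℂ_[p]) ≠ a) {P : Polynomial ℂ_[p]} (hP : P ≠ 0) :
    ¬ ∃ B : ℝ, ∀ n, ‖coeff n (PowerSeries.binomialSeries ℂ_[p] a * (P : PowerSeries ℂ_[p]))‖ ≤ B := by
  intro hb
  obtain ⟨B', hB'⟩ := KatzLineDescent.exists_norm_coeff_le_of_ode_of_mul_polynomial
    (KatzLineDescent.one_add_X_mul_derivative_binomialSeries a) P hP hb
  obtain ⟨b, hb⟩ := (KatzLineDescent.bddAbove_norm_coeff_binomialSeries_iff a).mp ⟨B', hB'⟩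
  exact ha b hb

/-- Equivalently: if `(1+T)^a · P` has bounded coefficients for some polynomial `P ≠ 0`, then `a ∈ ℤ_p`.
[cite: Washington1997, §5.1, §7.1 Prop. 7.2] -/
theorem exists_padicInt_eq_of_bddAbove_binomialSeries_mul_polynomial {a : ℂ_[p]} {P : Polynomial ℂ_[p]}
    (hP : P ≠ 0) (hb : ∃ B : ℝ, ∀ n, ‖coeff n (PowerSeries.binomialSeries ℂ_[p] a * (P : PowerSeries ℂ_[p]))‖ ≤ B) :
    ∃ b : ℤ_[p], ((b : ℚ_[p]) : ℂ_[p]) = a := by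
  by_contra h
  push Not at h
  exact not_bddAbove_binomialSeries_mul_polynomial h hP hb

end Binomial

end Summit.BirchSwinnertonDyer.BirchSwinnertonDyer.Theorems.GoodLatticeAnacongFrames

end
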